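import Summits.QuantumFields.YangMills.Theorems.BalabanUVNodesN15TwoGridLandauReduction
import HarnessLib

/-!
# Route «BalabanUVNodes», node N15 = NE2, -a lane, part 48: DOOR (iv) — THE KERNEL INEQUALITY `hK` OF PART 47 FROM THE TREE's FACTORISATION
# `(∂Π∂*)_{μν} = η^{d+1}·[∂_μG′Q′*]·(Q′G′²Q′*)⁻¹·[∂_νG′Q′*]ᵀ` (b05 `B5DPD126Uniform.dpd`): `hK` ⇐ a paired two-grid rate of the factor `∂G′Q′*`
# (King's Prop. 3.8 (3.71) line 2 SHAPE for b04's kernel `K_T`) + a two-grid rate of the unit-lattice inverse `(Q′G′²Q′*)⁻¹`, by Leibniz over the unit torus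

Cell `pub-ymgap`, seat `pub-ymgap-dag-n15-a` (KNIT-BY-NAME, g12); `--supports stmt-QuantumFields-20290 --as helper`; `HOME/pub-ymgap-dag-n15-a/DOOR-IV-PLAN.md` §7.4(a).
Over part 47 (`landauRe_single`, `hasMaj_landauSandwich_of_kernelRate`, `hasMaj_twoGridDefect_of_kernelRate`), lit-balaban∕b05's (1.126) engine `B5DPD126Uniform` (`dpd = DKRe·kerRe·DKReᵀ`,
`cIdx`, `toZ_cIdx`, `conv_decay`, `tdist_fine_le`, `tdist_eq_torusSupNorm`), `B5PBridgeKernel126.GradOp_PcT_GradOp_adjoint_apply` (`(∂·Π·∂ᴴ)((x,μ),(x′,ν)) = η^{d+1}·dpd … (torIdx x) (torIdx x′)`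
for EVERY `a > 0` — the projection does not see `a`), `B5PBridgeProjection.torIdx` (the chart `Tor ≃ Idx`), King's block geometry (`King1986.Torus.blockOf`, `MinimizerBlockDecay.blockOf_over`) and
n15-a part 4's `DefectKernel.card_fibre_kingProj`.
WHAT.  (§44) charts: `cIdx n M (torIdx x) = torIdx M (B(x))`, `tdistT = tdist ∘ torIdx`, `landauRe … (δ_{(z,ν)}) (x,μ) = (n^{d+1})⁻¹·dpd n a M μ ν (torIdx x) (torIdx z)` (any `a > 0`),
`dpd` unfolded as the double unit-torus sum.  (§45) `abs_sum_mul_sum_mul_le` — the triple convolution `|Σ_{k′}(Σ_k f(k)g(k,k′))h(k′)| ≤ ABC·K(δ∕2)K(δ∕4)·e^{−(δ∕4)t(b,b′)}` on the unit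
torus (b05 `conv_decay` twice).  (§46) ★★ `abs_cellAvg_dpd_sub_le` (ONE TORUS, explicit constants): decay of the factors on both grids (`CD, δ`) + the PAIRED RATE of the factor
`|DKRe′_s(torIdx w′, k) − DKRe_s(torIdx (pr w′), k)| ≤ ρ₁·e^{−δ t(B(pr w′), k)}` (`s = μ, ν`; King's pairing `pr = kingPr`) + the RATE of the inverse `|kerRe′ − kerRe|(k,k′) ≤ ρ₃·e^{−δ t(k,k′)}`
⇒ `|L^{−m(d+1)}Σ_{w′: pr w′ = z} dpd′(torIdx x′, torIdx w′) − dpd(torIdx (pr x′), torIdx z)| ≤ (2ρ₁ + ρ₃)·CD²·K(δ∕2)K(δ∕4)·e^{−(δ∕4)|B(pr x′) − B(z)|_T}` (three-term telescoping,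
the cell average of the right factor is an average of paired differences).  (§47) ★★ **`kernelRate_of_factorRates`**: the same read through `landauRe_single`∕the (1.126) dictionary as
PART 47's BINDER `hK` (`C_K·R_K·((L^k)^{d+1})⁻¹·e^{−(δ∕4)·distU}`, `|B(x)−B(z)|_T ≥ distU(x,z) − 1`), and ★★ **`hasMaj_twoGridDefect_of_factorRates`**: the factor rates on the torus
family of record (for SOME couplings `a, a′ ∈ [a₋, a₊]` per member — the tree's decays `DKRe_decay`∕`kerRe_decay` are uniform on `[a₋,a₊]`, and King's `a_K` live in such a window) ⇒
ENTRY 0 of `𝔇(G′, G)` for Bałaban's full `G = Δ_a⁻¹`.  So the located hard core is now: King's (3.71) lines 1–2 for b04's kernel `K_T = G′Q′*` at `m² = 0` (line 2 = `ρ₁`; line 1 feeds `ρ₃`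
through `(Q′G′²Q′*)⁻¹′ − (Q′G′²Q′*)⁻¹ = ker′(N − N′)ker`, part 49).
HONEST FRAMING ∕ LIMITS.  `ρ₁`, `ρ₃` are HYPOTHESES (King proves their scalar-model analogues, [King1986] Prop. 3.8 (3.71), for HIS `a_kG_kQ_k^*` with `m² > 0`; the identification
with b04's `K_T` and the passage `m² → 0` are NOT done here); nothing of [B5] asserted beyond the tree's theorems; constants crude and ours; tori of record `M_μ = 2L^{m_T}`; `U ≡ 1`;
count-neutral (typed 28∕28 · discharged 5∕28 unchanged); NOT a discharge of N15 (object-bound; NE2⁺ NOT PRINTED); one finite T⁴ at fixed ε — NOT infinite volume, NOT OS on ℝ⁴,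
NOT a mass gap, NOT Clay.
-/

noncomputable section

open scoped BigOperators Matrix
open Finset

namespace Summit.QuantumFields.YangMills.BalabanUVNodes.N15.TwoGrid

open Literature.MathematicalPhysics.QuantumFieldTheory.Balaban1983to89
open Literature.MathematicalPhysics.QuantumFieldTheory.Balaban1983to89.B11SectG (BlockNorm HasMaj)
open Literature.MathematicalPhysics.QuantumFieldTheory.Balaban1983to89.T4EtaRateCoeffDefect (pull pull_apply fibre mem_fibre)
open Literature.MathematicalPhysics.QuantumFieldTheory.Balaban1983to89.T4EtaRateDefect (idef)
open Literature.MathematicalPhysics.QuantumFieldTheory.Balaban1983to89.B5Prop11Plancherel (Tor fine unitVec)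
open Literature.MathematicalPhysics.QuantumFieldTheory.Balaban1983to89.B5Prop12FieldsLattice (distU distU_nonneg)
open Literature.MathematicalPhysics.QuantumFieldTheory.Balaban1983to89.B5SiteBridgeP12 (MP)
open Literature.MathematicalPhysics.QuantumFieldTheory.Balaban1983to89.B4Sect5Torus (TSite tdist tdist_triangle tdist_symm tdist_nonneg tdist_self)
open Literature.MathematicalPhysics.QuantumFieldTheory.Balaban1983to89.B4Green244 (coarse)
open Literature.MathematicalPhysics.QuantumFieldTheory.Balaban1983to89.B4TorusKernel (periodConst)
open Literature.MathematicalPhysics.QuantumFieldTheory.Balaban1983to89.B4TorusKernel.MultiPeriod (torusSupNorm)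
open Literature.MathematicalPhysics.QuantumFieldTheory.Balaban1983to89.B5QGGQ145Bounds (Idx toZ kerRe)
open Literature.MathematicalPhysics.QuantumFieldTheory.Balaban1983to89.B5DPD126Uniform (DKRe dpd cIdx toZ_cIdx conv_decay tdist_fine_le tdist_eq_torusSupNorm
  DKRe_decay kerRe_decay)
open Literature.MathematicalPhysics.QuantumFieldTheory.Balaban1983to89.B5PBridgeProjection (torIdx torIdx_apply)
open Literature.MathematicalPhysics.QuantumFieldTheory.Balaban1983to89.B5PBridgeKernel126 (GradOp_PcT_GradOp_adjoint_apply distU_eq_tdist)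
open Literature.MathematicalPhysics.QuantumFieldTheory.King1986.Torus (blockOf val_blockOf tdistT tdistT_nonneg blockOf_over)
open Literature.MathematicalPhysics.QuantumFieldTheory.Balaban1983to89.B6UnitTorusCarrier (unitTorusGeo)
open Summit.QuantumFields.YangMills.BalabanUVNodes.N15.DefectKernel (card_fibre_kingProj)
open Summit.QuantumFields.YangMills.BalabanUVNodes.N15.VectorPiece (blkFine kingPr kingPrV kingPr_val kingPrV_eq)

variable {d : ℕ}

/-! ## §44 Charts: King's blocks, the (1.126) dictionary, the unfolded factorisation -/

section Charts

variable (M : Fin (d + 1) → ℕ) [∀ μ, NeZero (M μ)] (n : ℕ) [NeZero n]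

/-- the block label of a fine site, read through the charts: `cIdx (torIdx x) = torIdx (B(x))`. [folklore] -/
theorem cIdx_torIdx (x : Tor (fine n M)) : cIdx n M (torIdx (fine n M) x) = torIdx M (blockOf n M x) := by
  funext i
  apply Fin.ext
  simp only [cIdx, torIdx_apply, B5RowSumsP12Lattice.chartSite_apply_val, val_blockOf]

/-- King's unit-torus distance IS pv23's `tdist` through the chart. [folklore] -/
theorem tdistT_eq_tdist_torIdx (y y' : Tor M) : tdistT M y y' = tdist M (torIdx M y) (torIdx M y') := rfl

/-- **THE (1.126) DICTIONARY FOR `landauRe`**: the entry of Bałaban's Landau term on real 1-forms at bonds `(x,μ) ← (z,ν)` is `η^{d+1}·dpd n a M μ ν (torIdx x) (torIdx z)` for EVERY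
`a > 0` (the projection `Π` does not depend on `a`). [cite: Balaban1984PropagatorsI, (1.120) p.37, (1.126) p.38, p.38 ll.7–10 (P = G′Q′*(Q′G′²Q′*)⁻¹Q′G′)] -/
theorem landauRe_single_eq_dpd {a : ℝ} (ha : 0 < a) (x : Tor (fine n M)) (μ : Fin (d + 1)) (z : Tor (fine n M)) (ν : Fin (d + 1)) :
    landauRe M n (Pi.single (z, ν) 1) (x, μ) = ((n : ℝ) ^ (d + 1))⁻¹ * dpd n a M μ ν (torIdx (fine n M) x) (torIdx (fine n M) z) := by
  rw [landauRe_single, GradOp_PcT_GradOp_adjoint_apply n M (Nat.one_le_iff_ne_zero.mpr (NeZero.ne n)) ha, Complex.ofReal_re]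

omit [∀ μ, NeZero (M μ)] in
/-- the factorisation unfolded: `dpd μ ν X Z = Σ_{k′} (Σ_k DKRe_μ X k · kerRe k k′) · DKRe_ν Z k′` (two unit-torus sums). [cite: Balaban1984PropagatorsI, p.38 ll.7–10] -/
theorem dpd_apply (a : ℝ) (μ ν : Fin (d + 1)) (X Z : Idx (fun i => n * M i)) :
    dpd n a M μ ν X Z = ∑ k' : Idx M, (∑ k : Idx M, DKRe n a M μ X k * kerRe n a M k k') * DKRe n a M ν Z k' := by
  rw [dpd, Matrix.mul_apply]
  refine sum_congr rfl fun k' _ => ?_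
  rw [Matrix.mul_apply, Matrix.transpose_apply]

end Charts

/-! ## §45 The triple convolution on the unit torus -/

section Convolution

omit d in
/-- **TRIPLE CONVOLUTION OF EXPONENTIALLY DECAYING UNIT-TORUS KERNELS** (`conv_decay` twice): `|Σ_{k′}(Σ_k f(k)g(k,k′))h(k′)| ≤ A·B·C·K(δ∕2)·K(δ∕4)·e^{−(δ∕4)t(b,b′)}`
(`K(σ) = latticeConst m σ`). [folklore] -/
theorem abs_sum_mul_sum_mul_le {m : ℕ} {P : Fin m → ℕ} (hP : ∀ i, 1 ≤ P i) {δ A B C : ℝ} (hδ : 0 < δ) (hC : 0 ≤ C)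
    (f : TSite m P → ℝ) (g : TSite m P → TSite m P → ℝ) (h : TSite m P → ℝ) (b b' : TSite m P)
    (hf : ∀ k, |f k| ≤ A * Real.exp (-(δ * tdist P b k))) (hg : ∀ k k', |g k k'| ≤ B * Real.exp (-(δ * tdist P k k')))
    (hh : ∀ k', |h k'| ≤ C * Real.exp (-(δ * tdist P k' b'))) :
    |∑ k', (∑ k, f k * g k k') * h k'| ≤ A * B * C * B4Sect5Proof.latticeConst m (δ / 2) * B4Sect5Proof.latticeConst m (δ / 4) * Real.exp (-(δ / 4 * tdist P b b')) := by
  have hinner : ∀ k', |∑ k, f k * g k k'| ≤ A * B * B4Sect5Proof.latticeConst m (δ / 2) * Real.exp (-(δ / 2 * tdist P b k')) :=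
    fun k' => conv_decay hP hδ f (fun k => g k k') b k' hf (fun k => hg k k')
  have hh' : ∀ k', |h k'| ≤ C * Real.exp (-(δ / 2 * tdist P k' b')) := fun k' => (hh k').trans
    (mul_le_mul_of_nonneg_left (Real.exp_le_exp.mpr (by nlinarith [tdist_nonneg P k' b'])) hC)
  have h2 := conv_decay hP (half_pos hδ) (fun k' => ∑ k, f k * g k k') h b b' hinner hh'
  rw [show δ / 2 / 2 = δ / 4 by ring] at h2
  exact h2.trans (le_of_eq (by ring))

end Convolution

/-! ## §46 ★★ The cell-averaged two-grid defect of `dpd` from the factor rates (one torus, explicit constants) -/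

section FactorRates

variable {L : ℕ} [NeZero L] (M : Fin (d + 1) → ℕ) [∀ μ, NeZero (M μ)] (k m : ℕ)

/-- ★★ **THE CELL-AVERAGED TWO-GRID DEFECT OF THE (1.126) KERNEL FROM THE FACTOR RATES.**  On one torus `M`, with coarse fineness `n = L^k` (coupling `a`) and fine fineness `n′ = L^m·L^k`
(coupling `a′`), assume: DECAY of the factors on both grids (`|DKRe_s(X, k)| ≤ C_D·e^{−δ·t(⌊X∕n⌋, k)}` for `s = μ, ν`, `|kerRe(k, k′)| ≤ C_D·e^{−δ·t(k,k′)}` — the tree's `DKRe_decay`∕`kerRe_decay`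
shapes), the PAIRED RATE of the factor (`|DKRe′_s(torIdx w′, k) − DKRe_s(torIdx (pr w′), k)| ≤ ρ₁·e^{−δ·t(⌊pr w′∕n⌋, k)}`) and the RATE of the inverse (`|kerRe′ − kerRe|(k,k′) ≤ ρ₃·e^{−δ·t(k,k′)}`).
Then for every fine bond base `x′` and coarse `z`: `|L^{−m(d+1)}·Σ_{w′: pr w′ = z} dpd′(torIdx x′, torIdx w′) − dpd(torIdx (pr x′), torIdx z)| ≤ (2ρ₁ + ρ₃)·C_D²·K(δ∕2)K(δ∕4)·e^{−(δ∕4)·|B(pr x′) − B(z)|_T}`.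
[cite: Balaban1984PropagatorsI, p.38 ll.7–10 (the factorisation of P); King1986, Prop. 3.8 (3.71) p.664 and Prop. 3.9 (3.73) p.664 (the shapes)] -/
theorem abs_cellAvg_dpd_sub_le {a a' CD δ ρ₁ ρ₃ : ℝ} (hCD : 0 ≤ CD) (hδ : 0 < δ) (hρ₁ : 0 ≤ ρ₁) (μ ν : Fin (d + 1))
    (hDK : ∀ (s : Fin (d + 1)) (X : Idx (fun i => L ^ k * M i)) (k' : Idx M), |DKRe (L ^ k) a M s X k'| ≤ CD * Real.exp (-(δ * tdist M (cIdx (L ^ k) M X) k')))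
    (hDK' : ∀ (s : Fin (d + 1)) (X : Idx (fun i => (L ^ m * L ^ k) * M i)) (k' : Idx M),
      |DKRe (L ^ m * L ^ k) a' M s X k'| ≤ CD * Real.exp (-(δ * tdist M (cIdx (L ^ m * L ^ k) M X) k')))
    (hker : ∀ k₁ k₂ : Idx M, |kerRe (L ^ k) a M k₁ k₂| ≤ CD * Real.exp (-(δ * tdist M k₁ k₂)))
    (hker' : ∀ k₁ k₂ : Idx M, |kerRe (L ^ m * L ^ k) a' M k₁ k₂| ≤ CD * Real.exp (-(δ * tdist M k₁ k₂)))
    (hR1 : ∀ (s : Fin (d + 1)) (w' : Tor (fine (L ^ m * L ^ k) M)) (k' : Idx M),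
      |DKRe (L ^ m * L ^ k) a' M s (torIdx (fine (L ^ m * L ^ k) M) w') k' - DKRe (L ^ k) a M s (torIdx (fine (L ^ k) M) (kingPr L k m M w')) k'|
        ≤ ρ₁ * Real.exp (-(δ * tdist M (cIdx (L ^ k) M (torIdx (fine (L ^ k) M) (kingPr L k m M w'))) k')))
    (hR3 : ∀ k₁ k₂ : Idx M, |kerRe (L ^ m * L ^ k) a' M k₁ k₂ - kerRe (L ^ k) a M k₁ k₂| ≤ ρ₃ * Real.exp (-(δ * tdist M k₁ k₂)))
    (x' : Tor (fine (L ^ m * L ^ k) M)) (z : Tor (fine (L ^ k) M)) :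
    |(((L ^ m : ℕ) : ℝ) ^ (d + 1))⁻¹ * ∑ w' ∈ fibre (kingPr L k m M) z, dpd (L ^ m * L ^ k) a' M μ ν (torIdx (fine (L ^ m * L ^ k) M) x') (torIdx (fine (L ^ m * L ^ k) M) w')
        - dpd (L ^ k) a M μ ν (torIdx (fine (L ^ k) M) (kingPr L k m M x')) (torIdx (fine (L ^ k) M) z)|
      ≤ (2 * ρ₁ + ρ₃) * CD ^ 2 * B4Sect5Proof.latticeConst (d + 1) (δ / 2) * B4Sect5Proof.latticeConst (d + 1) (δ / 4)
        * Real.exp (-(δ / 4 * tdistT M (blockOf (L ^ k) M (kingPr L k m M x')) (blockOf (L ^ k) M z))) := by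
  classical
  have hM1 : ∀ i, 1 ≤ M i := fun i => Nat.one_le_iff_ne_zero.mpr (NeZero.ne (M i))
  have hL0 : 0 < L := Nat.pos_of_ne_zero (NeZero.ne L)
  have hR0 : (0 : ℝ) < ((L ^ m : ℕ) : ℝ) ^ (d + 1) := pow_pos (by exact_mod_cast Nat.one_le_pow _ _ hL0) _
  set X' := torIdx (fine (L ^ m * L ^ k) M) x' with hX'
  set X := torIdx (fine (L ^ k) M) (kingPr L k m M x') with hX
  set Z := torIdx (fine (L ^ k) M) z with hZ
  set b : Idx M := torIdx M (blockOf (L ^ k) M (kingPr L k m M x')) with hb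
  set b' : Idx M := torIdx M (blockOf (L ^ k) M z) with hb'
  set K2 := B4Sect5Proof.latticeConst (d + 1) (δ / 2) with hK2
  set K4 := B4Sect5Proof.latticeConst (d + 1) (δ / 4) with hK4
  have hK2' : 0 ≤ K2 := B4Sect5Proof.latticeConst_nonneg (d + 1) (by positivity)
  have hK4' : 0 ≤ K4 := B4Sect5Proof.latticeConst_nonneg (d + 1) (by positivity)
  -- block labels through the charts
  have hbX : cIdx (L ^ k) M X = b := by rw [hX, cIdx_torIdx]
  have hbX' : cIdx (L ^ m * L ^ k) M X' = b := by
    rw [hX', cIdx_torIdx, hb, blockOf_over M (kingPr L k m M x') x' (kingPr_val L k m M x')]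
  have hbZ : cIdx (L ^ k) M Z = b' := by rw [hZ, cIdx_torIdx]
  have hbW : ∀ w' ∈ fibre (kingPr L k m M) z, cIdx (L ^ m * L ^ k) M (torIdx (fine (L ^ m * L ^ k) M) w') = b' := by
    intro w' hw'
    have hpr : kingPr L k m M w' = z := (mem_fibre _ _ _).mp hw'
    rw [cIdx_torIdx, hb', blockOf_over M (kingPr L k m M w') w' (kingPr_val L k m M w'), hpr]
  -- the cell average of the right factor and its two bounds
  set Dbar : Idx M → ℝ := fun k' => (((L ^ m : ℕ) : ℝ) ^ (d + 1))⁻¹ * ∑ w' ∈ fibre (kingPr L k m M) z, DKRe (L ^ m * L ^ k) a' M ν (torIdx (fine (L ^ m * L ^ k) M) w') k' with hDbar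
  have hcard : ((fibre (kingPr L k m M) z).card : ℝ) = ((L ^ m : ℕ) : ℝ) ^ (d + 1) := by
    rw [card_fibre_kingProj L k m M (kingPr L k m M) (kingPr_val L k m M) z]; push_cast; ring
  have hDbar_le : ∀ k', |Dbar k'| ≤ CD * Real.exp (-(δ * tdist M b' k')) := by
    intro k'
    rw [hDbar]; simp only
    rw [abs_mul, abs_of_pos (inv_pos.mpr hR0)]
    calc (((L ^ m : ℕ) : ℝ) ^ (d + 1))⁻¹ * |∑ w' ∈ fibre (kingPr L k m M) z, DKRe (L ^ m * L ^ k) a' M ν (torIdx (fine (L ^ m * L ^ k) M) w') k'|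
        ≤ (((L ^ m : ℕ) : ℝ) ^ (d + 1))⁻¹ * ∑ w' ∈ fibre (kingPr L k m M) z, CD * Real.exp (-(δ * tdist M b' k')) := by
          gcongr
          exact (abs_sum_le_sum_abs _ _).trans (sum_le_sum fun w' hw' => by rw [← hbW w' hw']; exact hDK' ν _ k')
      _ = CD * Real.exp (-(δ * tdist M b' k')) := by rw [sum_const, nsmul_eq_mul, hcard, ← mul_assoc, inv_mul_cancel₀ hR0.ne', one_mul]
  have hDbar_sub : ∀ k', |Dbar k' - DKRe (L ^ k) a M ν Z k'| ≤ ρ₁ * Real.exp (-(δ * tdist M b' k')) := by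
    intro k'
    have havg : Dbar k' - DKRe (L ^ k) a M ν Z k' = (((L ^ m : ℕ) : ℝ) ^ (d + 1))⁻¹ *
        ∑ w' ∈ fibre (kingPr L k m M) z, (DKRe (L ^ m * L ^ k) a' M ν (torIdx (fine (L ^ m * L ^ k) M) w') k' - DKRe (L ^ k) a M ν Z k') := by
      rw [hDbar]; simp only
      rw [sum_sub_distrib, sum_const, nsmul_eq_mul, hcard, mul_sub, ← mul_assoc, inv_mul_cancel₀ hR0.ne', one_mul]
    rw [havg, abs_mul, abs_of_pos (inv_pos.mpr hR0)]
    calc (((L ^ m : ℕ) : ℝ) ^ (d + 1))⁻¹ * |∑ w' ∈ fibre (kingPr L k m M) z, (DKRe (L ^ m * L ^ k) a' M ν (torIdx (fine (L ^ m * L ^ k) M) w') k' - DKRe (L ^ k) a M ν Z k')|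
        ≤ (((L ^ m : ℕ) : ℝ) ^ (d + 1))⁻¹ * ∑ w' ∈ fibre (kingPr L k m M) z, ρ₁ * Real.exp (-(δ * tdist M b' k')) := by
          gcongr
          refine (abs_sum_le_sum_abs _ _).trans (sum_le_sum fun w' hw' => ?_)
          have hpr : kingPr L k m M w' = z := (mem_fibre _ _ _).mp hw'
          have h1 := hR1 ν w' k'
          rw [hpr] at h1
          rw [← hbZ]; exact h1
      _ = ρ₁ * Real.exp (-(δ * tdist M b' k')) := by rw [sum_const, nsmul_eq_mul, hcard, ← mul_assoc, inv_mul_cancel₀ hR0.ne', one_mul]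
  -- the telescoping identity
  have hsplit : (((L ^ m : ℕ) : ℝ) ^ (d + 1))⁻¹ * ∑ w' ∈ fibre (kingPr L k m M) z, dpd (L ^ m * L ^ k) a' M μ ν X' (torIdx (fine (L ^ m * L ^ k) M) w') - dpd (L ^ k) a M μ ν X Z
      = ∑ k', (∑ k₁, (DKRe (L ^ m * L ^ k) a' M μ X' k₁ - DKRe (L ^ k) a M μ X k₁) * kerRe (L ^ m * L ^ k) a' M k₁ k') * Dbar k'
        + ∑ k', (∑ k₁, DKRe (L ^ k) a M μ X k₁ * (kerRe (L ^ m * L ^ k) a' M k₁ k' - kerRe (L ^ k) a M k₁ k')) * Dbar k'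
        + ∑ k', (∑ k₁, DKRe (L ^ k) a M μ X k₁ * kerRe (L ^ k) a M k₁ k') * (Dbar k' - DKRe (L ^ k) a M ν Z k') := by
    have e1 : (((L ^ m : ℕ) : ℝ) ^ (d + 1))⁻¹ * ∑ w' ∈ fibre (kingPr L k m M) z, dpd (L ^ m * L ^ k) a' M μ ν X' (torIdx (fine (L ^ m * L ^ k) M) w')
        = ∑ w' ∈ fibre (kingPr L k m M) z, ∑ k', (((L ^ m : ℕ) : ℝ) ^ (d + 1))⁻¹ *
          ((∑ k₁, DKRe (L ^ m * L ^ k) a' M μ X' k₁ * kerRe (L ^ m * L ^ k) a' M k₁ k') * DKRe (L ^ m * L ^ k) a' M ν (torIdx (fine (L ^ m * L ^ k) M) w') k') := by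
      rw [mul_sum]
      exact sum_congr rfl fun w' _ => by rw [dpd_apply, mul_sum]
    have e2 : ∑ k', (∑ k₁, DKRe (L ^ m * L ^ k) a' M μ X' k₁ * kerRe (L ^ m * L ^ k) a' M k₁ k') * Dbar k'
        = ∑ k', ∑ w' ∈ fibre (kingPr L k m M) z, (((L ^ m : ℕ) : ℝ) ^ (d + 1))⁻¹ *
          ((∑ k₁, DKRe (L ^ m * L ^ k) a' M μ X' k₁ * kerRe (L ^ m * L ^ k) a' M k₁ k') * DKRe (L ^ m * L ^ k) a' M ν (torIdx (fine (L ^ m * L ^ k) M) w') k') := by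
      refine sum_congr rfl fun k' _ => ?_
      rw [hDbar]
      simp only
      rw [mul_sum, mul_sum]
      exact sum_congr rfl fun w' _ => by ring
    rw [e1, sum_comm, ← e2, dpd_apply, ← sum_sub_distrib, ← sum_add_distrib, ← sum_add_distrib]
    refine sum_congr rfl fun k' _ => ?_
    have e3 : ∑ k₁, (DKRe (L ^ m * L ^ k) a' M μ X' k₁ - DKRe (L ^ k) a M μ X k₁) * kerRe (L ^ m * L ^ k) a' M k₁ k'
        = (∑ k₁, DKRe (L ^ m * L ^ k) a' M μ X' k₁ * kerRe (L ^ m * L ^ k) a' M k₁ k') - ∑ k₁, DKRe (L ^ k) a M μ X k₁ * kerRe (L ^ m * L ^ k) a' M k₁ k' := by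
      rw [← sum_sub_distrib]; exact sum_congr rfl fun _ _ => by ring
    have e4 : ∑ k₁, DKRe (L ^ k) a M μ X k₁ * (kerRe (L ^ m * L ^ k) a' M k₁ k' - kerRe (L ^ k) a M k₁ k')
        = (∑ k₁, DKRe (L ^ k) a M μ X k₁ * kerRe (L ^ m * L ^ k) a' M k₁ k') - ∑ k₁, DKRe (L ^ k) a M μ X k₁ * kerRe (L ^ k) a M k₁ k' := by
      rw [← sum_sub_distrib]; exact sum_congr rfl fun _ _ => by ring
    rw [e3, e4]
    ring
  -- the three triple convolutions
  have hkerS : ∀ k₁ k₂ : Idx M, |kerRe (L ^ m * L ^ k) a' M k₁ k₂| ≤ CD * Real.exp (-(δ * tdist M k₁ k₂)) := hker'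
  have T1 := abs_sum_mul_sum_mul_le hM1 hδ hCD (fun k₁ => DKRe (L ^ m * L ^ k) a' M μ X' k₁ - DKRe (L ^ k) a M μ X k₁) (fun k₁ k' => kerRe (L ^ m * L ^ k) a' M k₁ k') Dbar b b'
    (fun k₁ => by have h1 := hR1 μ x' k₁; rw [hbX] at h1; exact h1) hkerS (fun k' => by rw [tdist_symm hM1]; exact hDbar_le k')
  have T2 := abs_sum_mul_sum_mul_le hM1 hδ hCD (fun k₁ => DKRe (L ^ k) a M μ X k₁) (fun k₁ k' => kerRe (L ^ m * L ^ k) a' M k₁ k' - kerRe (L ^ k) a M k₁ k') Dbar b b'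
    (fun k₁ => by rw [← hbX]; exact hDK μ X k₁) hR3 (fun k' => by rw [tdist_symm hM1]; exact hDbar_le k')
  have T3 := abs_sum_mul_sum_mul_le hM1 hδ hρ₁ (fun k₁ => DKRe (L ^ k) a M μ X k₁) (fun k₁ k' => kerRe (L ^ k) a M k₁ k') (fun k' => Dbar k' - DKRe (L ^ k) a M ν Z k') b b'
    (fun k₁ => by rw [← hbX]; exact hDK μ X k₁) hker (fun k' => by rw [tdist_symm hM1]; exact hDbar_sub k')
  rw [hsplit, tdistT_eq_tdist_torIdx]
  have hE := Real.exp_nonneg (-(δ / 4 * tdist M b b'))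
  calc |∑ k', (∑ k₁, (DKRe (L ^ m * L ^ k) a' M μ X' k₁ - DKRe (L ^ k) a M μ X k₁) * kerRe (L ^ m * L ^ k) a' M k₁ k') * Dbar k'
        + ∑ k', (∑ k₁, DKRe (L ^ k) a M μ X k₁ * (kerRe (L ^ m * L ^ k) a' M k₁ k' - kerRe (L ^ k) a M k₁ k')) * Dbar k'
        + ∑ k', (∑ k₁, DKRe (L ^ k) a M μ X k₁ * kerRe (L ^ k) a M k₁ k') * (Dbar k' - DKRe (L ^ k) a M ν Z k')|
      ≤ |∑ k', (∑ k₁, (DKRe (L ^ m * L ^ k) a' M μ X' k₁ - DKRe (L ^ k) a M μ X k₁) * kerRe (L ^ m * L ^ k) a' M k₁ k') * Dbar k'|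
        + |∑ k', (∑ k₁, DKRe (L ^ k) a M μ X k₁ * (kerRe (L ^ m * L ^ k) a' M k₁ k' - kerRe (L ^ k) a M k₁ k')) * Dbar k'|
        + |∑ k', (∑ k₁, DKRe (L ^ k) a M μ X k₁ * kerRe (L ^ k) a M k₁ k') * (Dbar k' - DKRe (L ^ k) a M ν Z k')| := abs_add_three _ _ _
    _ ≤ ρ₁ * CD * CD * K2 * K4 * Real.exp (-(δ / 4 * tdist M b b')) + CD * ρ₃ * CD * K2 * K4 * Real.exp (-(δ / 4 * tdist M b b'))
        + CD * CD * ρ₁ * K2 * K4 * Real.exp (-(δ / 4 * tdist M b b')) := add_le_add (add_le_add T1 T2) T3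
    _ = (2 * ρ₁ + ρ₃) * CD ^ 2 * K2 * K4 * Real.exp (-(δ / 4 * tdist M b b')) := by ring

end FactorRates

/-! ## §47 ★★ `hK` of part 47 from the factor rates; entry 0 of `𝔇(G′, G)` from the factor rates -/

section Assembly

variable {L : ℕ} [NeZero L] (M : Fin (d + 1) → ℕ) [∀ μ, NeZero (M μ)] (k m : ℕ)

/-- **`hK` (ONE TORUS) FROM THE FACTOR RATES**: the hypotheses of `abs_cellAvg_dpd_sub_le` for every pair of directions give part 47's kernel inequality with `C_K·R_K = (2ρ₁ + ρ₃)·C_D²·K(δ∕2)K(δ∕4)·e^{δ∕4}`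
and rate `δ∕4` in `distU` (`|B(x) − B(z)|_T ≥ distU(x,z) − 1`, b05 `tdist_fine_le`). [cite: Balaban1984PropagatorsI, (1.126) p.38, p.38 ll.7–10; King1986, Prop. 3.9 p.664 (η-rate shape)] -/
theorem kernelRate_core {a a' CD δ ρ₁ ρ₃ : ℝ} (ha : 0 < a) (ha' : 0 < a') (hCD : 0 ≤ CD) (hδ : 0 < δ) (hρ₁ : 0 ≤ ρ₁) (hρ₃ : 0 ≤ ρ₃)
    (hDK : ∀ (s : Fin (d + 1)) (X : Idx (fun i => L ^ k * M i)) (k' : Idx M), |DKRe (L ^ k) a M s X k'| ≤ CD * Real.exp (-(δ * tdist M (cIdx (L ^ k) M X) k')))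
    (hDK' : ∀ (s : Fin (d + 1)) (X : Idx (fun i => (L ^ m * L ^ k) * M i)) (k' : Idx M),
      |DKRe (L ^ m * L ^ k) a' M s X k'| ≤ CD * Real.exp (-(δ * tdist M (cIdx (L ^ m * L ^ k) M X) k')))
    (hker : ∀ k₁ k₂ : Idx M, |kerRe (L ^ k) a M k₁ k₂| ≤ CD * Real.exp (-(δ * tdist M k₁ k₂)))
    (hker' : ∀ k₁ k₂ : Idx M, |kerRe (L ^ m * L ^ k) a' M k₁ k₂| ≤ CD * Real.exp (-(δ * tdist M k₁ k₂)))
    (hR1 : ∀ (s : Fin (d + 1)) (w' : Tor (fine (L ^ m * L ^ k) M)) (k' : Idx M),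
      |DKRe (L ^ m * L ^ k) a' M s (torIdx (fine (L ^ m * L ^ k) M) w') k' - DKRe (L ^ k) a M s (torIdx (fine (L ^ k) M) (kingPr L k m M w')) k'|
        ≤ ρ₁ * Real.exp (-(δ * tdist M (cIdx (L ^ k) M (torIdx (fine (L ^ k) M) (kingPr L k m M w'))) k')))
    (hR3 : ∀ k₁ k₂ : Idx M, |kerRe (L ^ m * L ^ k) a' M k₁ k₂ - kerRe (L ^ k) a M k₁ k₂| ≤ ρ₃ * Real.exp (-(δ * tdist M k₁ k₂)))
    (x' : Tor (fine (L ^ m * L ^ k) M)) (μ : Fin (d + 1)) (z : Tor (fine (L ^ k) M)) (ν : Fin (d + 1)) :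
    |∑ w' ∈ fibre (kingPr L k m M) z, landauRe M (L ^ m * L ^ k) (Pi.single (w', ν) 1) (x', μ) - landauRe M (L ^ k) (Pi.single (z, ν) 1) (kingPr L k m M x', μ)|
      ≤ ((2 * ρ₁ + ρ₃) * CD ^ 2 * B4Sect5Proof.latticeConst (d + 1) (δ / 2) * B4Sect5Proof.latticeConst (d + 1) (δ / 4) * Real.exp (δ / 4)) * 1
        * ((((L ^ k : ℕ) : ℝ)) ^ (d + 1))⁻¹ * Real.exp (-(δ / 4 * distU (L ^ k) M (kingPr L k m M x') z)) := by
  classical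
  have hL0 : 0 < L := Nat.pos_of_ne_zero (NeZero.ne L)
  have hn0 : (0 : ℝ) < (((L ^ k : ℕ) : ℝ)) ^ (d + 1) := pow_pos (by exact_mod_cast Nat.one_le_pow _ _ hL0) _
  have hR0 : (0 : ℝ) < (((L ^ m : ℕ) : ℝ)) ^ (d + 1) := pow_pos (by exact_mod_cast Nat.one_le_pow _ _ hL0) _
  haveI : NeZero (L ^ m * L ^ k) := ⟨Nat.mul_ne_zero (pow_ne_zero _ (NeZero.ne L)) (pow_ne_zero _ (NeZero.ne L))⟩
  have hn'pow : (((L ^ m * L ^ k : ℕ) : ℝ)) ^ (d + 1) = (((L ^ m : ℕ) : ℝ)) ^ (d + 1) * (((L ^ k : ℕ) : ℝ)) ^ (d + 1) := by push_cast; ring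
  -- the dictionary on both grids
  have hsum : ∑ w' ∈ fibre (kingPr L k m M) z, landauRe M (L ^ m * L ^ k) (Pi.single (w', ν) 1) (x', μ)
      = ((((L ^ k : ℕ) : ℝ)) ^ (d + 1))⁻¹ * ((((L ^ m : ℕ) : ℝ) ^ (d + 1))⁻¹ *
        ∑ w' ∈ fibre (kingPr L k m M) z, dpd (L ^ m * L ^ k) a' M μ ν (torIdx (fine (L ^ m * L ^ k) M) x') (torIdx (fine (L ^ m * L ^ k) M) w')) := by
    rw [← mul_assoc, mul_sum]
    refine sum_congr rfl fun w' _ => ?_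
    rw [landauRe_single_eq_dpd M (L ^ m * L ^ k) ha', hn'pow, mul_inv, mul_comm ((((L ^ m : ℕ) : ℝ)) ^ (d + 1))⁻¹]
  rw [hsum, landauRe_single_eq_dpd M (L ^ k) ha, ← mul_sub, abs_mul, abs_of_pos (inv_pos.mpr hn0)]
  have hcore := abs_cellAvg_dpd_sub_le M k m hCD hδ hρ₁ μ ν hDK hDK' hker hker' hR1 hR3 x' z
  -- from the block distance to `distU`
  have hdist : distU (L ^ k) M (kingPr L k m M x') z ≤ tdistT M (blockOf (L ^ k) M (kingPr L k m M x')) (blockOf (L ^ k) M z) + 1 := by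
    have hM1 : ∀ i, 1 ≤ M i := fun i => Nat.one_le_iff_ne_zero.mpr (NeZero.ne (M i))
    have hf := tdist_fine_le (L ^ k) hM1 (torIdx (fine (L ^ k) M) (kingPr L k m M x')) (torIdx (fine (L ^ k) M) z)
    rw [← toZ_cIdx, ← toZ_cIdx, ← tdist_eq_torusSupNorm hM1, cIdx_torIdx, cIdx_torIdx, ← tdistT_eq_tdist_torIdx] at hf
    have hnr : (0 : ℝ) < ((L ^ k : ℕ) : ℝ) := by exact_mod_cast Nat.one_le_pow _ _ hL0
    have hf' : tdist (fine (L ^ k) M) (torIdx (fine (L ^ k) M) (kingPr L k m M x')) (torIdx (fine (L ^ k) M) z)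
        ≤ ((L ^ k : ℕ) : ℝ) * tdistT M (blockOf (L ^ k) M (kingPr L k m M x')) (blockOf (L ^ k) M z) + (((L ^ k : ℕ) : ℝ) - 1) := hf
    rw [distU_eq_tdist, div_le_iff₀ hnr]
    nlinarith [tdistT_nonneg M (blockOf (L ^ k) M (kingPr L k m M x')) (blockOf (L ^ k) M z)]
  have hE : Real.exp (-(δ / 4 * tdistT M (blockOf (L ^ k) M (kingPr L k m M x')) (blockOf (L ^ k) M z)))
      ≤ Real.exp (δ / 4) * Real.exp (-(δ / 4 * distU (L ^ k) M (kingPr L k m M x') z)) := by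
    rw [← Real.exp_add]; exact Real.exp_le_exp.mpr (by nlinarith)
  have hK0 : 0 ≤ (2 * ρ₁ + ρ₃) * CD ^ 2 * B4Sect5Proof.latticeConst (d + 1) (δ / 2) * B4Sect5Proof.latticeConst (d + 1) (δ / 4) :=
    mul_nonneg (mul_nonneg (mul_nonneg (by positivity) (sq_nonneg _)) (B4Sect5Proof.latticeConst_nonneg _ (by positivity)))
      (B4Sect5Proof.latticeConst_nonneg _ (by positivity))
  calc ((((L ^ k : ℕ) : ℝ)) ^ (d + 1))⁻¹ * |(((L ^ m : ℕ) : ℝ) ^ (d + 1))⁻¹ *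
          ∑ w' ∈ fibre (kingPr L k m M) z, dpd (L ^ m * L ^ k) a' M μ ν (torIdx (fine (L ^ m * L ^ k) M) x') (torIdx (fine (L ^ m * L ^ k) M) w')
          - dpd (L ^ k) a M μ ν (torIdx (fine (L ^ k) M) (kingPr L k m M x')) (torIdx (fine (L ^ k) M) z)|
      ≤ ((((L ^ k : ℕ) : ℝ)) ^ (d + 1))⁻¹ * ((2 * ρ₁ + ρ₃) * CD ^ 2 * B4Sect5Proof.latticeConst (d + 1) (δ / 2) * B4Sect5Proof.latticeConst (d + 1) (δ / 4)
          * (Real.exp (δ / 4) * Real.exp (-(δ / 4 * distU (L ^ k) M (kingPr L k m M x') z)))) :=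
        mul_le_mul_of_nonneg_left (hcore.trans (mul_le_mul_of_nonneg_left hE hK0)) (inv_nonneg.mpr hn0.le)
    _ = _ := by ring

/-- ★★ **ENTRY 0 OF `𝔇(G′, G)` FROM THE FACTOR RATES.**  For odd `L > 1`, `a₀ > 0` (Bałaban's `a` in `Δ_a`), `0 < a₋ ≤ a₊`, `0 ≤ γ < 1`, `δ_R, ρ > 0`: IF on every member of the torus family of
record (`m_T`, `k ≥ 1`, `m`) there are couplings `a, a′ ∈ [a₋, a₊]` (e.g. King's `a_k`, `a_{k+m}`) for which the factor `∂G′Q′*` has the PAIRED RATE `ρ·(L^k)^{−γ}·e^{−δ_R t}` (King's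
(3.71) line 2 shape for b04's `K_T`) and the unit-lattice inverse `(Q′G′²Q′*)⁻¹` the RATE `ρ·(L^k)^{−γ}·e^{−δ_R t}`, THEN `𝔇(G′, G) = idef P P G′ G` for Bałaban's full `G = Δ_{a₀}⁻¹` has a block
majorant `C·(L^k)^{−γ}·e^{−δ|y−y′|_T}` — parts 43–47 + the tree's (1.126) engine (`DKRe_decay`, `kerRe_decay`, uniform on `[a₋, a₊]`). [cite: Balaban1984PropagatorsI, Prop. 1.2 (1.110) p.35, (1.126) p.38; King1986, Prop. 3.8 (3.71) p.664, Prop. 3.9 p.664] -/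
theorem hasMaj_twoGridDefect_of_factorRates (hL : Odd L ∧ 1 < L) {a₀ : ℝ} (ha₀ : 0 < a₀) {aminus aplus : ℝ} (hamin : 0 < aminus) {γ : ℝ} (hγ0 : 0 ≤ γ) (hγ1 : γ < 1)
    {δR ρ : ℝ} (hδR : 0 < δR) (hρ : 0 < ρ)
    (hfac : ∀ (mT k m : ℕ) (hk : 1 ≤ k), ∃ a a' : ℝ, aminus ≤ a ∧ a ≤ aplus ∧ aminus ≤ a' ∧ a' ≤ aplus ∧
      (∀ (s : Fin (d + 1)) (w' : Tor (fine (L ^ m * L ^ k) (MP (paramsOf d L mT k hL)))) (k' : Idx (MP (paramsOf d L mT k hL))),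
        |DKRe (L ^ m * L ^ k) a' (MP (paramsOf d L mT k hL)) s (torIdx (fine (L ^ m * L ^ k) (MP (paramsOf d L mT k hL))) w') k'
            - DKRe (L ^ k) a (MP (paramsOf d L mT k hL)) s (torIdx (fine (L ^ k) (MP (paramsOf d L mT k hL))) (kingPr L k m (MP (paramsOf d L mT k hL)) w')) k'|
          ≤ ρ * ((L ^ k : ℕ) : ℝ) ^ (-γ) *
            Real.exp (-(δR * tdist (MP (paramsOf d L mT k hL)) (cIdx (L ^ k) (MP (paramsOf d L mT k hL)) (torIdx (fine (L ^ k) (MP (paramsOf d L mT k hL))) (kingPr L k m (MP (paramsOf d L mT k hL)) w'))) k'))) ∧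
      (∀ k₁ k₂ : Idx (MP (paramsOf d L mT k hL)),
        |kerRe (L ^ m * L ^ k) a' (MP (paramsOf d L mT k hL)) k₁ k₂ - kerRe (L ^ k) a (MP (paramsOf d L mT k hL)) k₁ k₂|
          ≤ ρ * ((L ^ k : ℕ) : ℝ) ^ (-γ) * Real.exp (-(δR * tdist (MP (paramsOf d L mT k hL)) k₁ k₂)))) :
    ∃ δ C : ℝ, 0 < δ ∧ 0 < C ∧ ∀ (mT k m : ℕ) (hk : 1 ≤ k),
      HasMaj (BlockNorm.ofBlocks (unitTorusGeo L k (MP (paramsOf d L mT k hL))) (blkFine L k (MP (paramsOf d L mT k hL))))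
        (BlockNorm.ofBlocks (unitTorusGeo L k (MP (paramsOf d L mT k hL)))
          (fun i : Tor (fine (L ^ m * L ^ k) (MP (paramsOf d L mT k hL))) × Fin (d + 1) => blockOf (L ^ m * L ^ k) (MP (paramsOf d L mT k hL)) i.1))
        (idef (pull (kingPrV L k m (MP (paramsOf d L mT k hL)))) (pull (kingPrV L k m (MP (paramsOf d L mT k hL))))
          (gOp (MP (paramsOf d L mT k hL)) (L ^ m * L ^ k) a₀) (gOp (MP (paramsOf d L mT k hL)) (L ^ k) a₀))
        (fun y y' => C * ((L ^ k : ℕ) : ℝ) ^ (-γ) * Real.exp (-(δ * tdistT (MP (paramsOf d L mT k hL)) y y'))) := by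
  -- the tree's uniform decays of the two factors on `[a₋, a₊]`
  obtain ⟨κ₁, M₁, hκ₁, hM₁, HD⟩ := DKRe_decay d aminus aplus hamin
  obtain ⟨κ₂, M₂, hκ₂, hM₂, HK⟩ := kerRe_decay d aminus aplus hamin
  -- one rate and one constant for everything
  obtain ⟨δ, hδ⟩ : ∃ δ : ℝ, δ = min (min (κ₁ / (d + 1)) (κ₂ / (d + 1))) δR := ⟨_, rfl⟩
  have hd1 : (0 : ℝ) < (d : ℝ) + 1 := by positivity
  have hδpos : 0 < δ := hδ ▸ lt_min (lt_min (div_pos hκ₁ hd1) (div_pos hκ₂ hd1)) hδR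
  have hδ1 : δ ≤ κ₁ / (d + 1) := hδ ▸ (min_le_left _ _).trans (min_le_left _ _)
  have hδ2 : δ ≤ κ₂ / (d + 1) := hδ ▸ (min_le_left _ _).trans (min_le_right _ _)
  have hδ3 : δ ≤ δR := hδ ▸ min_le_right _ _
  have hpc1 : 0 ≤ periodConst κ₁ d := (B5Kernel166Decay.periodConst_pos hκ₁ d).le
  have hpc2 : 0 ≤ periodConst κ₂ d := (B5Kernel166Decay.periodConst_pos hκ₂ d).le
  obtain ⟨CD, hCD⟩ : ∃ CD : ℝ, CD = max (M₁ * periodConst κ₁ d) (M₂ * periodConst κ₂ d) := ⟨_, rfl⟩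
  have hCD0 : 0 ≤ CD := hCD ▸ le_max_of_le_left (mul_nonneg hM₁ hpc1)
  have hCD1 : M₁ * periodConst κ₁ d ≤ CD := hCD ▸ le_max_left _ _
  have hCD2 : M₂ * periodConst κ₂ d ≤ CD := hCD ▸ le_max_right _ _
  have hK2 : 0 ≤ B4Sect5Proof.latticeConst (d + 1) (δ / 2) := B4Sect5Proof.latticeConst_nonneg _ (by positivity)
  have hK4 : 0 ≤ B4Sect5Proof.latticeConst (d + 1) (δ / 4) := B4Sect5Proof.latticeConst_nonneg _ (by positivity)
  obtain ⟨CK, hCK⟩ : ∃ CK : ℝ, CK = (2 * ρ + ρ) * CD ^ 2 * B4Sect5Proof.latticeConst (d + 1) (δ / 2) * B4Sect5Proof.latticeConst (d + 1) (δ / 4) * Real.exp (δ / 4) := ⟨_, rfl⟩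
  have hCK0 : 0 ≤ CK := hCK ▸ mul_nonneg (mul_nonneg (mul_nonneg (mul_nonneg (by positivity) (sq_nonneg _)) hK2) hK4) (Real.exp_nonneg _)
  refine hasMaj_twoGridDefect_of_kernelRate (d := d) hL ha₀ hγ0 hγ1 (δK := δ / 4) (CK := CK + 1) (by positivity) (by linarith) fun mT k m hk x' μ z ν => ?_
  obtain ⟨a, a', ha1, ha2, ha1', ha2', HR1, HR3⟩ := hfac mT k m hk
  have ha : 0 < a := hamin.trans_le ha1
  have ha' : 0 < a' := hamin.trans_le ha1'
  have hM1 : ∀ i, 1 ≤ (MP (paramsOf d L mT k hL)) i := fun i => Nat.one_le_iff_ne_zero.mpr (NeZero.ne ((MP (paramsOf d L mT k hL)) i))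
  have hL0 : 0 < L := Nat.pos_of_ne_zero (NeZero.ne L)
  haveI : NeZero (L ^ m * L ^ k) := ⟨Nat.mul_ne_zero (pow_ne_zero _ (NeZero.ne L)) (pow_ne_zero _ (NeZero.ne L))⟩
  have hn0 : (0 : ℝ) < ((L ^ k : ℕ) : ℝ) := by exact_mod_cast Nat.one_le_pow _ _ hL0
  have hrγ : 0 ≤ ((L ^ k : ℕ) : ℝ) ^ (-γ) := Real.rpow_nonneg hn0.le _
  -- monotonicity helper: a tree decay `C·pc·e^{−(κ/(d+1))·‖·‖}` in `torusSupNorm` currency is `≤ CD·e^{−δ t}`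
  have hmono : ∀ {C pc κ' : ℝ} {N0 : Fin (d + 1) → ℕ} (_ : ∀ i, 1 ≤ N0 i) (X k' : Idx N0), C * pc ≤ CD → δ ≤ κ' →
      C * pc * Real.exp (-(κ' * torusSupNorm N0 (toZ X - toZ k'))) ≤ CD * Real.exp (-(δ * tdist N0 X k')) := by
    intro C pc κ' N0 hN0 X k' hC hκ
    rw [← tdist_eq_torusSupNorm hN0]
    by_cases hCp : 0 ≤ C * pc
    · exact mul_le_mul hC (Real.exp_le_exp.mpr (by nlinarith [tdist_nonneg N0 X k'])) (Real.exp_nonneg _) hCD0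
    · have h1 : C * pc * Real.exp (-(κ' * tdist N0 X k')) ≤ 0 := mul_nonpos_of_nonpos_of_nonneg (le_of_lt (not_le.mp hCp)) (Real.exp_nonneg _)
      exact h1.trans (mul_nonneg hCD0 (Real.exp_nonneg _))
  have hDKn : ∀ (n : ℕ) [NeZero n] {b : ℝ}, aminus ≤ b → b ≤ aplus → ∀ (s : Fin (d + 1)) (X : Idx (fun i => n * (MP (paramsOf d L mT k hL)) i)) (k' : Idx (MP (paramsOf d L mT k hL))),
      |DKRe n b (MP (paramsOf d L mT k hL)) s X k'| ≤ CD * Real.exp (-(δ * tdist (MP (paramsOf d L mT k hL)) (cIdx n (MP (paramsOf d L mT k hL)) X) k')) := by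
    intro n _ b hb1 hb2 s X k'
    have h := HD n b hb1 hb2 (MP (paramsOf d L mT k hL)) hM1 s X k'
    rw [← toZ_cIdx] at h
    exact h.trans (hmono hM1 (cIdx n (MP (paramsOf d L mT k hL)) X) k' hCD1 hδ1)
  have hkern : ∀ (n : ℕ) [NeZero n] {b : ℝ}, aminus ≤ b → b ≤ aplus → ∀ k₁ k₂ : Idx (MP (paramsOf d L mT k hL)), |kerRe n b (MP (paramsOf d L mT k hL)) k₁ k₂| ≤ CD * Real.exp (-(δ * tdist (MP (paramsOf d L mT k hL)) k₁ k₂)) := by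
    intro n _ b hb1 hb2 k₁ k₂
    exact (HK n b hb1 hb2 (MP (paramsOf d L mT k hL)) hM1 k₁ k₂).trans (hmono hM1 k₁ k₂ hCD2 hδ2)
  have hR1' : ∀ (s : Fin (d + 1)) (w' : Tor (fine (L ^ m * L ^ k) (MP (paramsOf d L mT k hL)))) (k' : Idx (MP (paramsOf d L mT k hL))),
      |DKRe (L ^ m * L ^ k) a' (MP (paramsOf d L mT k hL)) s (torIdx (fine (L ^ m * L ^ k) (MP (paramsOf d L mT k hL))) w') k' - DKRe (L ^ k) a (MP (paramsOf d L mT k hL)) s (torIdx (fine (L ^ k) (MP (paramsOf d L mT k hL))) (kingPr L k m (MP (paramsOf d L mT k hL)) w')) k'|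
        ≤ ρ * ((L ^ k : ℕ) : ℝ) ^ (-γ) * Real.exp (-(δ * tdist (MP (paramsOf d L mT k hL)) (cIdx (L ^ k) (MP (paramsOf d L mT k hL)) (torIdx (fine (L ^ k) (MP (paramsOf d L mT k hL))) (kingPr L k m (MP (paramsOf d L mT k hL)) w'))) k')) :=
    fun s w' k' => (HR1 s w' k').trans (mul_le_mul_of_nonneg_left (Real.exp_le_exp.mpr (by nlinarith [tdist_nonneg (MP (paramsOf d L mT k hL)) (cIdx (L ^ k) (MP (paramsOf d L mT k hL)) (torIdx (fine (L ^ k) (MP (paramsOf d L mT k hL))) (kingPr L k m (MP (paramsOf d L mT k hL)) w'))) k']))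
      (mul_nonneg hρ.le hrγ))
  have hR3' : ∀ k₁ k₂ : Idx (MP (paramsOf d L mT k hL)), |kerRe (L ^ m * L ^ k) a' (MP (paramsOf d L mT k hL)) k₁ k₂ - kerRe (L ^ k) a (MP (paramsOf d L mT k hL)) k₁ k₂| ≤ ρ * ((L ^ k : ℕ) : ℝ) ^ (-γ) * Real.exp (-(δ * tdist (MP (paramsOf d L mT k hL)) k₁ k₂)) :=
    fun k₁ k₂ => (HR3 k₁ k₂).trans (mul_le_mul_of_nonneg_left (Real.exp_le_exp.mpr (by nlinarith [tdist_nonneg (MP (paramsOf d L mT k hL)) k₁ k₂])) (mul_nonneg hρ.le hrγ))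
  have hcore := kernelRate_core (MP (paramsOf d L mT k hL)) k m ha ha' hCD0 hδpos (mul_nonneg hρ.le hrγ) (mul_nonneg hρ.le hrγ)
    (hDKn (L ^ k) ha1 ha2) (hDKn (L ^ m * L ^ k) ha1' ha2') (hkern (L ^ k) ha1 ha2) (hkern (L ^ m * L ^ k) ha1' ha2') hR1' hR3' x' μ z ν
  refine hcore.trans ?_
  have hE := Real.exp_nonneg (-(δ / 4 * distU (L ^ k) (MP (paramsOf d L mT k hL)) (kingPr L k m (MP (paramsOf d L mT k hL)) x') z))
  have hI : 0 ≤ ((((L ^ k : ℕ) : ℝ)) ^ (d + 1))⁻¹ := inv_nonneg.mpr (pow_nonneg hn0.le _)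
  have heq : (2 * (ρ * ((L ^ k : ℕ) : ℝ) ^ (-γ)) + ρ * ((L ^ k : ℕ) : ℝ) ^ (-γ)) * CD ^ 2 * B4Sect5Proof.latticeConst (d + 1) (δ / 2) * B4Sect5Proof.latticeConst (d + 1) (δ / 4)
      * Real.exp (δ / 4) * 1 = CK * ((L ^ k : ℕ) : ℝ) ^ (-γ) := by rw [hCK]; ring
  rw [heq]
  exact mul_le_mul_of_nonneg_right (mul_le_mul_of_nonneg_right (mul_le_mul_of_nonneg_right (by linarith) hrγ) hI) hE

end Assembly

end Summit.QuantumFields.YangMills.BalabanUVNodes.N15.TwoGrid
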